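import Literature.AlgebraicGeometry.Resolution.BlowupSNC
import Literature.AlgebraicGeometry.Resolution.MonomialMarkedIdeals
import Summits.ResolutionOfSingularities.ResolutionOfSingularities.Theorems.EquisingularLiftEquisingularLiftNatTowerBAwayTransport
import HarnessLib

/-!
# [OURS · L1 W4.5(b) · EL♮(3)] T23-A′ brick (A′-2) — the strict transform of a boundary member crossed TRANSVERSALLY by the centre is REGULAR
# (simple-normal-crossings transport; desk R6 (ii), SIG `L/res-L1-w45b-stub-4/T23Aprime-TransversalTransport.sig.lean`)

res-L1-w45b-stub-4 g10 (T23-A engine owner; research object T23-A′ per res-L1-w45b-plan-1 g19's RULING R6 (ii)). Crux EL♮(3) = stmt-ResolutionOfSingularities-20148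
(parent stmt-…-20038), route `EquisingularLift`, line `sections`. OURS; NOT a statement of any manuscript; AI-written, weaker than expert review. DEF-FREE; no
`sorry`; standard axioms; `--supports stmt-ResolutionOfSingularities-20148 --as helper`.

WHAT. The regularity clause (e-iii′) of the widened round transport `RoundTransportOK′` (engine word `T23A-ENGINE-WORD.md` 340f00d84dbcbbfc §T23-A′): if the
retained member's upstairs model `V(𝓕)` and the round's centre `C` have SIMPLE NORMAL CROSSINGS (`HasSNCWith [𝓕] C`, tree `MarkedIdeals`), then after the
blow-up `τ` of `C` the strict transform `St_C 𝓕` cuts a REGULAR closed subscheme — Kollár 2007 Def. 3.25 / BGMW 2011 Def. 3.1.3 as PROVED in the tree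
(`HasSNCWith.hasSNC_transform`, BlowupSNC; `HasSNC.isRegular_subscheme_finsetSup`, MonomialMarkedIdeals). Also the exceptional divisor `C·𝒪` is regular and the
pair `[St 𝓕, C·𝒪]` is again snc (recorded for (A′-3)). Pure composition of tree theorems.
-/

set_option linter.dupNamespace false

noncomputable section

open CategoryTheory CategoryTheory.Limits AlgebraicGeometry TopologicalSpace
open Literature.AlgebraicGeometry.Resolution
open AlgebraicGeometry.Scheme.IdealSheafData

namespace Summit.ResolutionOfSingularities.ResolutionOfSingularities.Cruxes.EquisingularLiftNat.Sections

variable {X X₂ : Scheme.{0}} {C 𝓕 : X.IdealSheafData} {τ : X₂ ⟶ X}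

/-- **(A′-2, snc form) After blowing up a centre having simple normal crossings with the member, the strict transform of the member and the
exceptional divisor form an snc pair.** [cite: Kollar2007, Def. 3.25] [cite: BierstoneGrigorievMilmanWlodarczyk2011, Def. 3.1.3 (2), (4)]
[OURS · L1 W4.5b · T23-A′] -/
theorem hasSNC_strictTransform_pair_of_hasSNCWith [IsLocallyNoetherian X] (hE : HasSNCWith [𝓕] C) (hτ : IsBlowup τ C) :
    HasSNC [strictTransformIdeal τ C 𝓕, C.comap τ] := by
  simpa only [List.map_cons, List.map_nil, List.singleton_append] using hE.hasSNC_transform hτ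

/-- **(A′-2) The strict transform of a member crossed with simple normal crossings by the centre is a regular closed subscheme.**
[cite: Kollar2007, Def. 3.25] [cite: Matsumura1987, Thm. 14.2] [OURS · L1 W4.5b · T23-A′ brick (e-iii′)]; NOT a statement of the manuscript. -/
theorem isRegular_subscheme_strictTransformIdeal_of_hasSNCWith [IsLocallyNoetherian X] [IsLocallyNoetherian X₂] (hE : HasSNCWith [𝓕] C)
    (hτ : IsBlowup τ C) : Scheme.IsRegular (strictTransformIdeal τ C 𝓕).subscheme := by
  classical
  have hsnc := hasSNC_strictTransform_pair_of_hasSNCWith hE hτ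
  have h := hsnc.isRegular_subscheme_finsetSup {strictTransformIdeal τ C 𝓕} (fun K hK => by
    rw [Finset.mem_singleton] at hK; subst hK; simp)
  have e : (({strictTransformIdeal τ C 𝓕} : Finset X₂.IdealSheafData).sup id) = strictTransformIdeal τ C 𝓕 := by
    rw [Finset.sup_singleton, id]
  rw [e] at h
  exact h

/-- **(A′-2, exceptional) The exceptional divisor of such a blow-up is a regular closed subscheme as well.** [cite: Kollar2007, Def. 3.25]
[OURS · L1 W4.5b · T23-A′] -/
theorem isRegular_subscheme_comap_of_hasSNCWith [IsLocallyNoetherian X] [IsLocallyNoetherian X₂] (hE : HasSNCWith [𝓕] C) (hτ : IsBlowup τ C) :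
    Scheme.IsRegular (C.comap τ).subscheme := by
  classical
  have hsnc := hasSNC_strictTransform_pair_of_hasSNCWith hE hτ
  have h := hsnc.isRegular_subscheme_finsetSup {C.comap τ} (fun K hK => by
    rw [Finset.mem_singleton] at hK; subst hK; simp)
  have e : (({C.comap τ} : Finset X₂.IdealSheafData).sup id) = C.comap τ := by rw [Finset.sup_singleton, id]
  rw [e] at h
  exact h

/-- **The stage after the blow-up is regular** (every local ring), from the same snc hypothesis. [cite: Kollar2007, Def. 3.25] [OURS · L1 W4.5b · T23-A′] -/
theorem isRegular_of_hasSNCWith_blowup [IsLocallyNoetherian X] (hE : HasSNCWith [𝓕] C) (hτ : IsBlowup τ C) : Scheme.IsRegular X₂ :=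
  fun x' => hτ.isRegularLocalRing_stalk_of_hasSNCWith hE x'

end Summit.ResolutionOfSingularities.ResolutionOfSingularities.Cruxes.EquisingularLiftNat.Sections

end
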